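import Mathlib
import HarnessLib
import Summits.RiemannHypothesis.RiemannHypothesis.Theses.WeilParity
import Summits.RiemannHypothesis.RiemannHypothesis.Theses.GroundBarta
import Summits.RiemannHypothesis.RiemannHypothesis.Theorems.WeilParityEvenWinsBeyondArchSplit
import Summits.RiemannHypothesis.RiemannHypothesis.Theorems.WeilParityEvenWinsBeyondArchFrontier63
import Summits.RiemannHypothesis.RiemannHypothesis.Theorems.WeilGroundStateGroundStateSimpleEvenCellTransfer
import Summits.RiemannHypothesis.RiemannHypothesis.Theorems.WeilGroundStateGroundStateSimpleEvenTwoPrimeWindows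
import Summits.RiemannHypothesis.RiemannHypothesis.Theorems.WeilGroundStateGroundStateSimpleEvenTrialUpperG
import Summits.RiemannHypothesis.RiemannHypothesis.Theorems.WeilGroundStateGroundStateSimpleEvenTrialUpperH
import Summits.RiemannHypothesis.RiemannHypothesis.Theorems.WeilGroundStateGroundStateSimpleEvenTrialUpperK

/-!
# Crux `EvenWinsBeyondArch` (stmt-RiemannHypothesis-15432; GroundBarta rung 4 = stmt-RiemannHypothesis-18807)
# and `NoParityCrossing` (stmt-RiemannHypothesis-18085): the frontier at `log 2` MODULO the two odd-sector
# L-sides of cells G and H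

Support file.  The RH-free ladder stub `stub_twoThreeWindowSimpleEven` of item 18085 (`WeilWindowSimpleEven a` on
the `{2,3}`-window `(log 3)/2 < a ≤ log 2`) is certified up to `63/100` (cells E, F:
`Theorems.weilWindowSimpleEven_of_le_63_100`).  The two remaining cells of the cell transfer
`GroundStateSimpleEven.weilWindowSimpleEven_on_cell_of_le` are

| cell | U-side (LANDED, this seat) | L-side (WANTED: odd-sector margin certificate) |
|---|---|---|
| `G = [63/100, 2/3]` | `trialUpperG : ε(63/100) ≤ 21/10¹¹` (true `≈ 2.03·10⁻¹⁰`) | `L_G ≤ Re Q(g)` for odd normalised `g` on `[-2/3, 2/3]`, some `L_G > 21/10¹¹` (odd bottom `≈ 3·10⁻⁹`) |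
| `H = [2/3, log 2]`  | `trialUpperH : ε(2/3) ≤ 1/10¹¹` (true `≈ 9.0·10⁻¹²`)    | `L_H ≤ Re Q(g)` for odd normalised `g` on `[-log 2, log 2]`, some `L_H > 1/10¹¹` (odd bottom `≈ 4·10⁻¹⁰`; two-prime form `E₂₃ = Re Q` on `C(log 2)`; take the certificate at a rational `a₀` JUST above `log 2`, e.g. `6932/10000` — NOT `7/10`: the odd bottom of `E₂₃` itself turns negative by `a₀ = 7/10`, where the prime power `4` is missing from `E₂₃`; odd polynomial Ritz of `E₂₃` at `7/10`: `−2.0·10⁻¹⁰`) |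

Optional refinement (cell K, U-side `trialUpperK : ε(13/20) ≤ 9/(2·10¹¹)`, true `≈ 4.1·10⁻¹¹`): splitting G at `13/20` into
`G₁ = [63/100, 13/20]` and `K = [13/20, 2/3]` lowers every L-side requirement to a few percent of the true odd bottom
(`L(13/20) > 21/10¹¹` vs odd bottom `≈ 10⁻⁸`; `L(2/3) > 9/(2·10¹¹)` vs `≈ 3·10⁻⁹`; `L(log 2) > 1/10¹¹` vs `≈ 4·10⁻¹⁰`), so that the landed
`T = 80` cell chain of the two-prime minorant (`WeilTwoPrimeCellsT80*`) should suffice for all three certificates.  The three-cell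
composition is `weilWindowSimpleEven_of_le_log_two_of_oddLower₃`; the two-cell statements below are its corollaries (an odd lower bound
at window `2/3` is one at window `13/20`).

This file composes the U-sides with the two L-sides TAKEN AS HYPOTHESES (stated verbatim in the shape the cell transfer
consumes, with the margins `L_G`, `L_H` as parameters), so that the seat landing the certificates closes the
`{2,3}`-window by `exact`:

1. `weilWindowSimpleEven_of_le_log_two_of_oddLower`: the Connes–van Suijlekom clause on EVERY window `0 < a ≤ log 2`;
   `twoThreeWindowSimpleEven_of_oddLower`: the ladder stub `stub_twoThreeWindowSimpleEven` of 18085 verbatim;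
2. `weilEvenGroundEnergy_lt_weilOddGroundEnergy_of_le_log_two_of_oddLower`: strict parity order up to `log 2`;
3. `noParityCrossing_iff_beyond_log_two_of_oddLower`: item 18085 ↔ "no parity tie beyond `log 2`" (Connes' tail);
4. `evenWinsBeyondArch_of_noTie_beyond_log_two_of_oddLower` and its GroundBarta transport
   (`GroundBarta.evenWinsBeyondArch_of_noTie_beyond_log_two_of_oddLower`, `Iff.rfl` copy): the cruxes 15432 / 18807
   from the tail statement `∀ a > log 2, ε_ev(a) ≠ ε_od(a)` plus the two certificates.

Mathlib + landed tree files only; no definitions, no named facts, no `sorry`.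
-/

noncomputable section

open Set MeasureTheory

-- D-0017: single-problem summit ⇒ namespace `Summit.RiemannHypothesis.RiemannHypothesis.…` by design.
set_option linter.dupNamespace false

namespace Summit.RiemannHypothesis.RiemannHypothesis.Theorems.EvenWinsBeyondArch

open Literature.NumberTheory.LFunctions
open Summit.RiemannHypothesis.RiemannHypothesis.Theses.WeilParity

/-! ## The `{2,3}`-window up to `log 2` from the two L-sides -/

/-- **Three cells composed with the landed U-sides** (`G₁ = [63/100, 13/20]`, `K = [13/20, 2/3]`, `H = [2/3, log 2]`):
odd-sector lower bounds `L₁ > 21/10¹¹` at window `13/20`, `L₂ > 9/(2·10¹¹)` at window `2/3` and `L₃ > 1/10¹¹` at window `log 2`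
(the three WANTED certificates) give `WeilWindowSimpleEven a` on EVERY window `0 < a ≤ log 2` (below `63/100`: cells A–F, landed;
U-sides `trialUpperG`, `trialUpperK`, `trialUpperH`). [folklore] -/
theorem weilWindowSimpleEven_of_le_log_two_of_oddLower₃ {L₁ L₂ L₃ : ℝ}
    (h₁ : (21 / 100000000000 : ℝ) < L₁)
    (hL₁ : ∀ g : ℝ → ℂ, IsWeilTest g → tsupport g ⊆ Icc (-(13 / 20 : ℝ)) (13 / 20) →
      ∫ t, ‖g t‖ ^ 2 = (1 : ℝ) → (∀ t, g (-t) = -g t) → L₁ ≤ (weilQuadratic g).re)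
    (h₂ : (9 / 200000000000 : ℝ) < L₂)
    (hL₂ : ∀ g : ℝ → ℂ, IsWeilTest g → tsupport g ⊆ Icc (-(2 / 3 : ℝ)) (2 / 3) →
      ∫ t, ‖g t‖ ^ 2 = (1 : ℝ) → (∀ t, g (-t) = -g t) → L₂ ≤ (weilQuadratic g).re)
    (h₃ : (1 / 100000000000 : ℝ) < L₃)
    (hL₃ : ∀ g : ℝ → ℂ, IsWeilTest g → tsupport g ⊆ Icc (-Real.log 2) (Real.log 2) →
      ∫ t, ‖g t‖ ^ 2 = (1 : ℝ) → (∀ t, g (-t) = -g t) → L₃ ≤ (weilQuadratic g).re) :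
    ∀ a : ℝ, 0 < a → a ≤ Real.log 2 → WeilWindowSimpleEven a := by
  intro a ha hle
  rcases le_or_gt a (63 / 100) with h63 | h63
  · exact Summit.RiemannHypothesis.RiemannHypothesis.Theorems.weilWindowSimpleEven_of_le_63_100 a ha h63
  rcases le_or_gt a (13 / 20) with h65 | h65
  · exact GroundStateSimpleEven.weilWindowSimpleEven_on_cell_of_le (b := 63 / 100) (c := 13 / 20)
      (U := 21 / 100000000000) (L := L₁) (by norm_num) h₁
      Summit.RiemannHypothesis.RiemannHypothesis.Theorems.trialUpperG hL₁ h63.le h65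
  rcases le_or_gt a (2 / 3) with h23 | h23
  · exact GroundStateSimpleEven.weilWindowSimpleEven_on_cell_of_le (b := 13 / 20) (c := 2 / 3)
      (U := 9 / 200000000000) (L := L₂) (by norm_num) h₂
      Summit.RiemannHypothesis.RiemannHypothesis.Theorems.trialUpperK hL₂ h65.le h23
  · exact GroundStateSimpleEven.weilWindowSimpleEven_on_cell_of_le (b := 2 / 3) (c := Real.log 2)
      (U := 1 / 100000000000) (L := L₃) (by norm_num) h₃
      Summit.RiemannHypothesis.RiemannHypothesis.Theorems.trialUpperH hL₃ h23.le hle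

/-- **Cells G and H composed with the landed U-sides**: if every `L²`-normalised ODD Weil test on `[-2/3, 2/3]` has
`Re Q ≥ L_G` for some `L_G > 21/10¹¹` (L-side of cell G; `trialUpperG` is the U-side) and every `L²`-normalised odd
Weil test on `[-log 2, log 2]` has `Re Q ≥ L_H` for some `L_H > 1/10¹¹` (L-side of cell H; `trialUpperH`), then
`WeilWindowSimpleEven a` holds on EVERY window `0 < a ≤ log 2` (corollary of the three-cell form: an odd lower bound at
window `2/3` is one at window `13/20`, and `21/10¹¹ > 9/(2·10¹¹)`). [folklore] -/
theorem weilWindowSimpleEven_of_le_log_two_of_oddLower {LG LH : ℝ}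
    (hG : (21 / 100000000000 : ℝ) < LG)
    (hLG : ∀ g : ℝ → ℂ, IsWeilTest g → tsupport g ⊆ Icc (-(2 / 3 : ℝ)) (2 / 3) →
      ∫ t, ‖g t‖ ^ 2 = (1 : ℝ) → (∀ t, g (-t) = -g t) → LG ≤ (weilQuadratic g).re)
    (hH : (1 / 100000000000 : ℝ) < LH)
    (hLH : ∀ g : ℝ → ℂ, IsWeilTest g → tsupport g ⊆ Icc (-Real.log 2) (Real.log 2) →
      ∫ t, ‖g t‖ ^ 2 = (1 : ℝ) → (∀ t, g (-t) = -g t) → LH ≤ (weilQuadratic g).re) :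
    ∀ a : ℝ, 0 < a → a ≤ Real.log 2 → WeilWindowSimpleEven a :=
  weilWindowSimpleEven_of_le_log_two_of_oddLower₃ (L₁ := LG) (L₂ := LG) (L₃ := LH) hG
    (fun g hg hs hn ho ↦ hLG g hg (hs.trans (Icc_subset_Icc (by norm_num) (by norm_num))) hn ho)
    (lt_trans (by norm_num) hG) hLG hH hLH

/-- **The ladder stub `stub_twoThreeWindowSimpleEven` of item 18085 (verbatim statement) from the two L-sides.**
[folklore] -/
theorem twoThreeWindowSimpleEven_of_oddLower {LG LH : ℝ}
    (hG : (21 / 100000000000 : ℝ) < LG)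
    (hLG : ∀ g : ℝ → ℂ, IsWeilTest g → tsupport g ⊆ Icc (-(2 / 3 : ℝ)) (2 / 3) →
      ∫ t, ‖g t‖ ^ 2 = (1 : ℝ) → (∀ t, g (-t) = -g t) → LG ≤ (weilQuadratic g).re)
    (hH : (1 / 100000000000 : ℝ) < LH)
    (hLH : ∀ g : ℝ → ℂ, IsWeilTest g → tsupport g ⊆ Icc (-Real.log 2) (Real.log 2) →
      ∫ t, ‖g t‖ ^ 2 = (1 : ℝ) → (∀ t, g (-t) = -g t) → LH ≤ (weilQuadratic g).re) :
    ∀ a : ℝ, Real.log 3 / 2 < a → a ≤ Real.log 2 →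
      Literature.NumberTheory.LFunctions.WeilWindowSimpleEven a :=
  fun a ha hle ↦ weilWindowSimpleEven_of_le_log_two_of_oddLower hG hLG hH hLH a
    (lt_trans (div_pos (Real.log_pos (by norm_num)) two_pos) ha) hle

/-- **Strict parity order up to `log 2`** from the two L-sides: `ε_ev(a) < ε_od(a)` for `0 < a ≤ log 2`. [folklore] -/
theorem weilEvenGroundEnergy_lt_weilOddGroundEnergy_of_le_log_two_of_oddLower {LG LH : ℝ}
    (hG : (21 / 100000000000 : ℝ) < LG)
    (hLG : ∀ g : ℝ → ℂ, IsWeilTest g → tsupport g ⊆ Icc (-(2 / 3 : ℝ)) (2 / 3) →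
      ∫ t, ‖g t‖ ^ 2 = (1 : ℝ) → (∀ t, g (-t) = -g t) → LG ≤ (weilQuadratic g).re)
    (hH : (1 / 100000000000 : ℝ) < LH)
    (hLH : ∀ g : ℝ → ℂ, IsWeilTest g → tsupport g ⊆ Icc (-Real.log 2) (Real.log 2) →
      ∫ t, ‖g t‖ ^ 2 = (1 : ℝ) → (∀ t, g (-t) = -g t) → LH ≤ (weilQuadratic g).re)
    {a : ℝ} (ha : 0 < a) (hle : a ≤ Real.log 2) :
    weilEvenGroundEnergy a < weilOddGroundEnergy a :=
  (weilWindowSimpleEven_iff_weilEvenGroundEnergy_lt ha).1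
    (weilWindowSimpleEven_of_le_log_two_of_oddLower hG hLG hH hLH a ha hle)

/-! ## The residue after the certificates: Connes' tail beyond `log 2` -/

/-- **`NoParityCrossing` from "no tie beyond `log 2`"** given the two L-sides: on `((log 3)/2, log 2]` the
strict order is then certified, beyond it is the hypothesis. [folklore] -/
theorem noParityCrossing_of_beyond_log_two_of_oddLower {LG LH : ℝ}
    (hG : (21 / 100000000000 : ℝ) < LG)
    (hLG : ∀ g : ℝ → ℂ, IsWeilTest g → tsupport g ⊆ Icc (-(2 / 3 : ℝ)) (2 / 3) →
      ∫ t, ‖g t‖ ^ 2 = (1 : ℝ) → (∀ t, g (-t) = -g t) → LG ≤ (weilQuadratic g).re)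
    (hH : (1 / 100000000000 : ℝ) < LH)
    (hLH : ∀ g : ℝ → ℂ, IsWeilTest g → tsupport g ⊆ Icc (-Real.log 2) (Real.log 2) →
      ∫ t, ‖g t‖ ^ 2 = (1 : ℝ) → (∀ t, g (-t) = -g t) → LH ≤ (weilQuadratic g).re)
    (h : ∀ a : ℝ, Real.log 2 < a → weilEvenGroundEnergy a ≠ weilOddGroundEnergy a) :
    NoParityCrossing := by
  intro a ha
  rcases le_or_gt a (Real.log 2) with hle | hlt
  · have ha0 : 0 < a := lt_trans (div_pos (Real.log_pos (by norm_num)) two_pos) ha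
    exact ne_of_lt (weilEvenGroundEnergy_lt_weilOddGroundEnergy_of_le_log_two_of_oddLower hG hLG hH hLH ha0 hle)
  · exact h a hlt

/-- **`NoParityCrossing` ⟹ no tie beyond `log 2`** (trivial restriction, `(log 3)/2 < log 2`). [folklore] -/
theorem beyond_log_two_of_noParityCrossing (h : NoParityCrossing) :
    ∀ a : ℝ, Real.log 2 < a → weilEvenGroundEnergy a ≠ weilOddGroundEnergy a := by
  intro a ha
  have hl3 := Real.log_three_lt_d9
  have hl2 := Real.log_two_gt_d9
  exact h a (by linarith)

/-- **Item 18085 after cells G, H: `NoParityCrossing` ↔ no parity tie beyond `log 2`** (given the two L-sides). [folklore] -/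
theorem noParityCrossing_iff_beyond_log_two_of_oddLower {LG LH : ℝ}
    (hG : (21 / 100000000000 : ℝ) < LG)
    (hLG : ∀ g : ℝ → ℂ, IsWeilTest g → tsupport g ⊆ Icc (-(2 / 3 : ℝ)) (2 / 3) →
      ∫ t, ‖g t‖ ^ 2 = (1 : ℝ) → (∀ t, g (-t) = -g t) → LG ≤ (weilQuadratic g).re)
    (hH : (1 / 100000000000 : ℝ) < LH)
    (hLH : ∀ g : ℝ → ℂ, IsWeilTest g → tsupport g ⊆ Icc (-Real.log 2) (Real.log 2) →
      ∫ t, ‖g t‖ ^ 2 = (1 : ℝ) → (∀ t, g (-t) = -g t) → LH ≤ (weilQuadratic g).re) :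
    NoParityCrossing ↔ ∀ a : ℝ, Real.log 2 < a → weilEvenGroundEnergy a ≠ weilOddGroundEnergy a :=
  ⟨beyond_log_two_of_noParityCrossing, noParityCrossing_of_beyond_log_two_of_oddLower hG hLG hH hLH⟩

/-- **The crux `EvenWinsBeyondArch` from "no tie beyond `log 2`"** and the two L-sides (landed split glue
`evenWinsBeyondArch_of_subs` with `onePrimeWindowSimpleEven_proof`). [folklore] -/
theorem evenWinsBeyondArch_of_noTie_beyond_log_two_of_oddLower {LG LH : ℝ}
    (hG : (21 / 100000000000 : ℝ) < LG)
    (hLG : ∀ g : ℝ → ℂ, IsWeilTest g → tsupport g ⊆ Icc (-(2 / 3 : ℝ)) (2 / 3) →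
      ∫ t, ‖g t‖ ^ 2 = (1 : ℝ) → (∀ t, g (-t) = -g t) → LG ≤ (weilQuadratic g).re)
    (hH : (1 / 100000000000 : ℝ) < LH)
    (hLH : ∀ g : ℝ → ℂ, IsWeilTest g → tsupport g ⊆ Icc (-Real.log 2) (Real.log 2) →
      ∫ t, ‖g t‖ ^ 2 = (1 : ℝ) → (∀ t, g (-t) = -g t) → LH ≤ (weilQuadratic g).re)
    (h : ∀ a : ℝ, Real.log 2 < a → weilEvenGroundEnergy a ≠ weilOddGroundEnergy a) :
    EvenWinsBeyondArch :=
  evenWinsBeyondArch_of_subs WeilParity.onePrimeWindowSimpleEven_proof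
    (noParityCrossing_of_beyond_log_two_of_oddLower hG hLG hH hLH h)

/-- **What the crux still asserts after cells G, H**: given the two L-sides,
`EvenWinsBeyondArch ↔ ∀ a > log 2, ε_ev(a) ≤ ε_od(a)`. [folklore] -/
theorem evenWinsBeyondArch_iff_forall_le_beyond_log_two_of_oddLower {LG LH : ℝ}
    (hG : (21 / 100000000000 : ℝ) < LG)
    (hLG : ∀ g : ℝ → ℂ, IsWeilTest g → tsupport g ⊆ Icc (-(2 / 3 : ℝ)) (2 / 3) →
      ∫ t, ‖g t‖ ^ 2 = (1 : ℝ) → (∀ t, g (-t) = -g t) → LG ≤ (weilQuadratic g).re)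
    (hH : (1 / 100000000000 : ℝ) < LH)
    (hLH : ∀ g : ℝ → ℂ, IsWeilTest g → tsupport g ⊆ Icc (-Real.log 2) (Real.log 2) →
      ∫ t, ‖g t‖ ^ 2 = (1 : ℝ) → (∀ t, g (-t) = -g t) → LH ≤ (weilQuadratic g).re) :
    EvenWinsBeyondArch ↔ ∀ a : ℝ, Real.log 2 < a → weilEvenGroundEnergy a ≤ weilOddGroundEnergy a := by
  rw [evenWinsBeyondArch_iff_forall_le]
  refine ⟨fun h' a ha ↦ h' a (lt_trans (by have := Real.log_two_lt_d9; have := Real.log_two_gt_d9; linarith) ha),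
    fun h' a ha ↦ ?_⟩
  rcases le_or_gt a (Real.log 2) with hle | hlt
  · exact (weilEvenGroundEnergy_lt_weilOddGroundEnergy_of_le_log_two_of_oddLower hG hLG hH hLH
      (log_two_half_pos.trans ha) hle).le
  · exact h' a hlt

end Summit.RiemannHypothesis.RiemannHypothesis.Theorems.EvenWinsBeyondArch

/-! ## Transport to the GroundBarta copy (stmt-RiemannHypothesis-18807, rung 4 of route GroundBarta) -/

namespace Summit.RiemannHypothesis.RiemannHypothesis.Theorems.GroundBarta

open Literature.NumberTheory.LFunctions

/-- **GroundBarta's rung 4 from "no tie beyond `log 2`" and the two L-sides of cells G, H** (transport of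
`EvenWinsBeyondArch.evenWinsBeyondArch_of_noTie_beyond_log_two_of_oddLower` along the `Iff.rfl` copy
`GroundBarta.evenWinsBeyondArch_iff_weilParity`). [folklore] -/
theorem evenWinsBeyondArch_of_noTie_beyond_log_two_of_oddLower {LG LH : ℝ}
    (hG : (21 / 100000000000 : ℝ) < LG)
    (hLG : ∀ g : ℝ → ℂ, IsWeilTest g → tsupport g ⊆ Icc (-(2 / 3 : ℝ)) (2 / 3) →
      ∫ t, ‖g t‖ ^ 2 = (1 : ℝ) → (∀ t, g (-t) = -g t) → LG ≤ (weilQuadratic g).re)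
    (hH : (1 / 100000000000 : ℝ) < LH)
    (hLH : ∀ g : ℝ → ℂ, IsWeilTest g → tsupport g ⊆ Icc (-Real.log 2) (Real.log 2) →
      ∫ t, ‖g t‖ ^ 2 = (1 : ℝ) → (∀ t, g (-t) = -g t) → LH ≤ (weilQuadratic g).re)
    (h : ∀ a : ℝ, Real.log 2 < a → weilEvenGroundEnergy a ≠ weilOddGroundEnergy a) :
    Summit.RiemannHypothesis.RiemannHypothesis.Theses.GroundBarta.EvenWinsBeyondArch :=
  evenWinsBeyondArch_iff_weilParity.2
    (EvenWinsBeyondArch.evenWinsBeyondArch_of_noTie_beyond_log_two_of_oddLower hG hLG hH hLH h)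

/-- **The even ground energy is below `21/10¹¹` at every window `a ≥ 63/100` and below `1/10¹¹` at every
`a ≥ 2/3`** (antitonicity of `ε` in the window + the landed U-sides) — the scale any L-side / ground-state
argument beyond the certified frontier has to resolve. [folklore] -/
theorem weilGroundEnergy_le_of_ge_63_100 {a : ℝ} (ha : (63 / 100 : ℝ) ≤ a) :
    weilGroundEnergy a ≤ 21 / 100000000000 :=
  (Summit.RiemannHypothesis.Cruxes.GronwallLeakage.Negative.weilGroundEnergy_antitone_of_pos (by norm_num) ha).trans
    Summit.RiemannHypothesis.RiemannHypothesis.Theorems.trialUpperG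

/-- See `weilGroundEnergy_le_of_ge_63_100`: `ε(a) ≤ 1/10¹¹` for `a ≥ 2/3`. [folklore] -/
theorem weilGroundEnergy_le_of_ge_two_thirds {a : ℝ} (ha : (2 / 3 : ℝ) ≤ a) :
    weilGroundEnergy a ≤ 1 / 100000000000 :=
  (Summit.RiemannHypothesis.Cruxes.GronwallLeakage.Negative.weilGroundEnergy_antitone_of_pos (by norm_num) ha).trans
    Summit.RiemannHypothesis.RiemannHypothesis.Theorems.trialUpperH

end Summit.RiemannHypothesis.RiemannHypothesis.Theorems.GroundBarta

end
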